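import Summits.BirchSwinnertonDyer.Rank1Residual.GaloisImage.KuriharaRecordBSDpThreeLevelOneEndOfBaseRigidity
import Summits.BirchSwinnertonDyer.Rank1Residual.GaloisImage.KuriharaRecordBSDpThreeLevelOneEndOfFacts
import Summits.BirchSwinnertonDyer.Rank1Residual.Additive.X4ThreeKuriharaCertKernelLValue
import HarnessLib

/-!
# END-m1 record corollaries WITHOUT the analytic-rank binder: `r_an = 0` READ OFF the level-zero
# unit value `δ̃_1 ≢ 0 (mod 27)` (cell `b2b-bsdres`, team n1011, seat p03, OWNERS row T-R1-57-REC
# record-side tool; the ENDs are n1011-p18's `GaloisImage/KuriharaRecordBSDpThreeLevelOneEndOfBaseRigidity.lean`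
# (p292786); the `L`-value lemma is p03's `Additive/X4ThreeKuriharaCertKernelLValue.lean` (p257658))

HONEST FRAMING (cell `b2b-bsdres`, run/shared/lean/b2b/bsd-rank1-residual/, verbatim in every
file): the goal of the cell is to DELETE the COMBINATION-SHAPED residual classes of the
Birch–Swinnerton-Dyer formula for ALL analytic-rank `≤ 1` elliptic curves over `ℚ` — "full BSD
formula for every rank `≤ 1` curve in class `C`" assembled STRICTLY from published theorems — so
that the rank-`≤ 1` remainder becomes exactly the CONSTRUCTION-SHAPED classes, which are TYPED
(missing-input `Prop`s), NOT attempted. This is not "finishing BSD". Team n1011 (N10/N11, the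
additive block `X4 ∧ p = 3`): research route; PER-PAIR record SHAPE, NOT a class theorem; TOOL
theorems only (no definition, no named fact); nothing booked; no mark / label moved; the shapes
below CLOSE NOTHING.  END-m1 is DEBT REDUCTION, not coverage.

## What and why

n1011-p18's [S24]-free END-m1 record corollaries
`Assembly.bsdp_three_{of_towerSurj,potMult}_of_levelOneCertificates_of_baseRigidity` carry, among
their binders, BOTH the EVIDENCE binder `hr : W.analyticRank = 0` (Cremona) AND the level-zero unit
field `hunit₁ : kuriharaNumber D.f (3 ^ 3) 1 ψ₂₇ ≠ 0` (`δ̃_1 ≢ 0 (mod 27)`).  The second IMPLIES the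
first with no new mathematics: `δ̃_1 = \overline{[0]⁺_{D.f}}` (Kim 2022 §1.4.3, tree
`kuriharaNumber_one`), so `δ̃_1 ≢ 0 (mod 27)` gives `[0]⁺_{D.f} ≠ 0`, hence `L(E,1) = [0]⁺_f·Ω⁺_f ≠ 0`
(`D.isNewformOf`, Mazur–Tate–Teitelbaum (8.6)), hence `r_an(E) = 0` under the entire continuation
`hmod` — p03's landed `analyticRank_eq_zero_of_kuriharaNumber_one_ne_zero` (p257658).  This file
states the two `_of_baseRigidity` ENDs AND the two NAMED-FACTS ENDs `…_of_facts` (p294284, PT family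
as the named fact `hPT : poitouTate_selmerStructure_duality ℚ`) WITHOUT `hr` (suffix `_noRank`; every other
binder unchanged, in the same order) and proves them by feeding `hr := analyticRank_eq_zero_of_kuriharaNumber_one_ne_zero hmod D (3^3) ψ₂₇ hunit₁`
to n1011-p18's theorems.  Effect on the END-m1 record series (`Additive/X4ThreeKuriharaEndM1Records*`,
36 rows): the per-pair EVIDENCE binders shrink from {`hr`, `D`/`hopt`, `hδ`} to {`D`/`hopt`, `hδ`} for
any consumer that instantiates these forms — the analytic rank is no longer a separate input of the
record.  Nothing else changes: the PORT, the PT family + `hEP`, `hCT`, the UPPER-half named facts, the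
optimal datum and the three Kurihara VALUES (EVIDENCE) remain hypotheses; nothing is booked.

References: C.-H. Kim, AJM 148 (2026) §1.4.3, Thm. 1.9 (6), Thm. 3.13 [Kim2022StructureSelmer];
B. Mazur, J. Tate, J. Teitelbaum, Invent. Math. 84 (1986) §I.8 (8.6) [MazurTateTeitelbaum1986Invent];
K. Rubin, PCMI 18 (2011) Thm. 2.8.4 [Rubin2011]; K. Kato, Astérisque 295 (2004) Thm. 14.5 (3)
[Kato2004Asterisque]; D. Delbourgo (1998) Prop. 4 [Delbourgo1998]; Agashe–Ribet–Stein (2006) Thm. 2.6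
[AgasheRibetStein2006]; J. H. Silverman, AEC (2009) X.4.14 [SilvermanAEC2009]; cell files
cells/n1011/ROUTE-1.md §33.3, OWNERS.md (T-R1-57-B, T-R1-57-REC).
-/

noncomputable section

open scoped Classical NumberField ContRepresentation
open Function Field NumberField IsDedekindDomain IsDedekindDomain.HeightOneSpectrum WeierstrassCurve
  CongruenceSubgroup
  Literature.NumberTheory.EllipticCurves Literature.NumberTheory.EllipticCurves.ModularForms
  Literature.NumberTheory.EllipticCurves.Rank1Residual
  Literature.NumberTheory.EllipticCurves.AgasheRibetStein2006
  Literature.NumberTheory.GaloisRepresentations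
  Literature.NumberTheory.GaloisRepresentations.DiscreteGaloisModule Literature.NumberTheory.GaloisCohomology
  Rat.HeightOneSpectrum
  Summit.BirchSwinnertonDyer.Rank1Residual.Additive Summit.BirchSwinnertonDyer.Rank1Residual.X4

namespace Summit.BirchSwinnertonDyer.Rank1Residual.GaloisImage.Assembly

/-- **END-m1 RECORD COROLLARY, [S24]-FREE, WITHOUT the analytic-rank binder (potentially GOOD rows / tower
form).**  Exactly n1011-p18's `bsdp_three_of_towerSurj_of_levelOneCertificates_of_baseRigidity` with the
binder `hr : W.analyticRank = 0` DELETED: `r_an = 0` is READ OFF the level-zero unit field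
`hunit₁ : δ̃_1 ≢ 0 (mod 27)` by `analyticRank_eq_zero_of_kuriharaNumber_one_ne_zero` (`δ̃_1 = [0]⁺_{D.f} mod 27`
non-zero ⟹ `L(E,1) ≠ 0` ⟹ `r_an = 0` under `hmod`).  All other binders unchanged and in the same order:
UPPER facts, `hCT`, the row (`hI hΔ hc₄ htower ht0 htam`), optimal datum at `N ≤ 130000`, the PT
family (`inv hperf hsum hcompl`), `hEP`, `v₃`, the port, and the certificate (`n hn hcyc ψ hψ hcert hzero₁
ψ₂₇ hunit₁`).  CLOSES NOTHING; the Kurihara values stay EVIDENCE hypotheses; nothing booked.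
[cite: Kim2022StructureSelmer, §1.4.3 (PDF p. 7), Thm. 1.9 (6) and Thm. 3.13]
[cite: MazurTateTeitelbaum1986Invent, §I.8 (8.6)] [cite: Rubin2011, Thm. 2.8.4]
[cite: Kato2004Asterisque, Thm. 14.5 (3) (p. 236)] [cite: AgasheRibetStein2006, Thm. 2.6 (p. 619)] -/
theorem bsdp_three_of_towerSurj_of_levelOneCertificates_of_baseRigidity_noRank
    (hKatoS : Kato2004.rankZero_padicValNat_sha_le_sub_localTamagawa_of_additive_potGood_of_imageContainsSL2)
    (hDel : Delbourgo1998.prop4_rankZero_pow_dvd_constantCoeff)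
    (hGZK : rank_eq_analyticRank_of_analyticRank_le_one) (hmod : hasEntireLFunction_rat)
    (hmodD : nonempty_modularParametrizationData)
    (hKatoχ : Wuthrich2014.kato_halfEigenCharIdeal_dvd_cyclotomicPrime_of_surjective)
    (h26 : cremona_abs_maninConstant_eq_one_of_level_le)
    (hCT : exists_casselsTate_pairing (K := ℚ))
    (W : WeierstrassCurve ℚ) [W.IsElliptic] [W.IsGloballyMinimal]
    {E₀ : WeierstrassCurve ℤ} (hI : integralModelInt W = E₀)
    (hΔ : (3 : ℤ) ∣ E₀.Δ) (hc₄ : (3 : ℤ) ∣ E₀.c₄)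
    (htower : ∀ m : ℕ, W.HasSurjectiveModNGaloisRep (3 ^ m : ℕ))
    (ht0 : Nat.card {Q : (W.baseChange ℚ_[3]).toAffine.Point // (3 : ℕ) • Q = 0} = 1)
    (htam : ¬ 3 ∣ W.tamagawaProduct)
    {N : ℕ} [NeZero N] (hN : N ≤ 130000) (D : ModularParametrizationData W N)
    (hopt : ∀ z ∈ D.L.lattice, ∃ w ∈ periodLattice D.f, z = D.c * w)
    (inv : LocalInvariants ℚ 3) (hperf : inv.IsPerfect) (hsum : inv.SumLocalTermEqZero)
    (hcompl : inv.SelmerComplement)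
    (hEP : ∀ v : HeightOneSpectrum (𝓞 ℚ), localEulerPoincareCharacteristic (v.adicCompletion ℚ))
    (v₃ : HeightOneSpectrum (𝓞 ℚ)) (hv₃ : ((3 : ℕ) : 𝓞 ℚ) ∈ v₃.asIdeal)
    (hPort : KatoKuriharaPortThreeAt W 0 v₃)
    (n : ℕ) [NeZero n] (hn : Kato.IsKolyvaginProduct W 3 1 n)
    (hcyc : ∀ (ℓ : ℕ) [Fact ℓ.Prime], ℓ ∣ n →
      Nat.card {P : ((integralModelInt W).map (Int.castRingHom (ZMod ℓ))).toAffine.Point //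
        3 • P = 0} ≤ 3)
    (ψ : (ℓ : ℕ) → (ZMod ℓ)ˣ →* Multiplicative (ZMod (3 ^ 1)))
    (hψ : ∀ ℓ ∈ n.primeFactors, Function.Surjective (ψ ℓ))
    (hcert : kuriharaNumber D.f (3 ^ 1) n ψ ≠ 0)
    (hzero₁ : kuriharaNumber D.f (3 ^ 1) 1 ψ = 0)
    (ψ₂₇ : (ℓ : ℕ) → (ZMod ℓ)ˣ →* Multiplicative (ZMod (3 ^ 3)))
    (hunit₁ : kuriharaNumber D.f (3 ^ 3) 1 ψ₂₇ ≠ 0) :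
    BSDp W 3 :=
  bsdp_three_of_towerSurj_of_levelOneCertificates_of_baseRigidity hKatoS hDel hGZK hmod hmodD hKatoχ h26
    hCT W hI hΔ hc₄ htower ht0
    (analyticRank_eq_zero_of_kuriharaNumber_one_ne_zero hmod D (3 ^ 3) ψ₂₇ hunit₁) htam hN D hopt inv
    hperf hsum hcompl hEP v₃ hv₃ hPort n hn hcyc ψ hψ hcert hzero₁ ψ₂₇ hunit₁

/-- **END-m1 RECORD COROLLARY, [S24]-FREE, WITHOUT the analytic-rank binder (potentially MULTIPLICATIVE
rows).**  Exactly n1011-p18's `bsdp_three_potMult_of_levelOneCertificates_of_baseRigidity` with the binder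
`hr : W.analyticRank = 0` DELETED (`r_an = 0` read off `hunit₁` by
`analyticRank_eq_zero_of_kuriharaNumber_one_ne_zero`); all other binders unchanged and in the same order.
CLOSES NOTHING; the Kurihara values stay EVIDENCE hypotheses; nothing booked.
[cite: Kim2022StructureSelmer, §1.4.3 (PDF p. 7), Thm. 1.9 (6) and Thm. 3.13]
[cite: MazurTateTeitelbaum1986Invent, §I.8 (8.6)] [cite: Rubin2011, Thm. 2.8.4]
[cite: Delbourgo1998, Prop. 4 (p. 144)] [cite: AgasheRibetStein2006, Thm. 2.6 (p. 619)] -/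
theorem bsdp_three_potMult_of_levelOneCertificates_of_baseRigidity_noRank
    (hKatoS : Kato2004.rankZero_padicValNat_sha_le_sub_localTamagawa_of_additive_potGood_of_imageContainsSL2)
    (hDel : Delbourgo1998.prop4_rankZero_pow_dvd_constantCoeff)
    (hGZK : rank_eq_analyticRank_of_analyticRank_le_one) (hmod : hasEntireLFunction_rat)
    (hmodD : nonempty_modularParametrizationData)
    (hKatoχ : Wuthrich2014.kato_halfEigenCharIdeal_dvd_cyclotomicPrime_of_surjective)
    (h26 : cremona_abs_maninConstant_eq_one_of_level_le)
    (hCT : exists_casselsTate_pairing (K := ℚ))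
    (W : WeierstrassCurve ℚ) [W.IsElliptic] [W.IsGloballyMinimal]
    {E₀ : WeierstrassCurve ℤ} (hI : integralModelInt W = E₀)
    (hΔ : (3 : ℤ) ∣ E₀.Δ) (hc₄ : (3 : ℤ) ∣ E₀.c₄)
    (hsurj : W.HasSurjectiveModNGaloisRep ((3 : ℕ) : ℤ)) (hjneg : padicValRat 3 W.j < 0)
    (hc3 : ¬ 3 ∣ (W.baseChange ℚ_[3]).localTamagawaNumber ℤ_[3])
    (ht0 : Nat.card {Q : (W.baseChange ℚ_[3]).toAffine.Point // (3 : ℕ) • Q = 0} = 1)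
    {N : ℕ} [NeZero N] (hN : N ≤ 130000) (D : ModularParametrizationData W N)
    (hopt : ∀ z ∈ D.L.lattice, ∃ w ∈ periodLattice D.f, z = D.c * w)
    (inv : LocalInvariants ℚ 3) (hperf : inv.IsPerfect) (hsum : inv.SumLocalTermEqZero)
    (hcompl : inv.SelmerComplement)
    (hEP : ∀ v : HeightOneSpectrum (𝓞 ℚ), localEulerPoincareCharacteristic (v.adicCompletion ℚ))
    (v₃ : HeightOneSpectrum (𝓞 ℚ)) (hv₃ : ((3 : ℕ) : 𝓞 ℚ) ∈ v₃.asIdeal)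
    (hPort : KatoKuriharaPortThreeAt W 0 v₃)
    (n : ℕ) [NeZero n] (hn : Kato.IsKolyvaginProduct W 3 1 n)
    (hcyc : ∀ (ℓ : ℕ) [Fact ℓ.Prime], ℓ ∣ n →
      Nat.card {P : ((integralModelInt W).map (Int.castRingHom (ZMod ℓ))).toAffine.Point //
        3 • P = 0} ≤ 3)
    (ψ : (ℓ : ℕ) → (ZMod ℓ)ˣ →* Multiplicative (ZMod (3 ^ 1)))
    (hψ : ∀ ℓ ∈ n.primeFactors, Function.Surjective (ψ ℓ))
    (hcert : kuriharaNumber D.f (3 ^ 1) n ψ ≠ 0)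
    (hzero₁ : kuriharaNumber D.f (3 ^ 1) 1 ψ = 0)
    (ψ₂₇ : (ℓ : ℕ) → (ZMod ℓ)ˣ →* Multiplicative (ZMod (3 ^ 3)))
    (hunit₁ : kuriharaNumber D.f (3 ^ 3) 1 ψ₂₇ ≠ 0) :
    BSDp W 3 :=
  bsdp_three_potMult_of_levelOneCertificates_of_baseRigidity hKatoS hDel hGZK hmod hmodD hKatoχ h26 hCT
    W hI hΔ hc₄ hsurj hjneg hc3 ht0
    (analyticRank_eq_zero_of_kuriharaNumber_one_ne_zero hmod D (3 ^ 3) ψ₂₇ hunit₁) hN D hopt inv hperf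
    hsum hcompl hEP v₃ hv₃ hPort n hn hcyc ψ hψ hcert hzero₁ ψ₂₇ hunit₁


/-! ### The NAMED-FACTS forms (`…_of_facts`, p294284) without `hr` -/

/-- **END-m1 RECORD COROLLARY, NAMED-FACTS form, WITHOUT the analytic-rank binder (potentially GOOD rows /
tower form).**  Exactly n1011-p18's `bsdp_three_of_towerSurj_of_levelOneCertificates_of_facts` (PT family as
the named fact `hPT : poitouTate_selmerStructure_duality ℚ`) with `hr : W.analyticRank = 0` DELETED — `r_an = 0`
read off `hunit₁` by `analyticRank_eq_zero_of_kuriharaNumber_one_ne_zero`; all other binders unchanged and in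
the same order.  On this form EVERY non-certificate hypothesis of an END-m1 record is a NAMED FACT or one of
the per-pair EVIDENCE binders {`D`/`hopt`, the three values}.  CLOSES NOTHING; nothing booked.
[cite: Kim2022StructureSelmer, §1.4.3 (PDF p. 7), Thm. 1.9 (6) and Thm. 3.13]
[cite: MazurTateTeitelbaum1986Invent, §I.8 (8.6)] [cite: Rubin2011, Thm. 2.8.4]
[cite: Kato2004Asterisque, Thm. 14.5 (3) (p. 236)] [cite: AgasheRibetStein2006, Thm. 2.6 (p. 619)] -/
theorem bsdp_three_of_towerSurj_of_levelOneCertificates_of_facts_noRank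
    (hKatoS : Kato2004.rankZero_padicValNat_sha_le_sub_localTamagawa_of_additive_potGood_of_imageContainsSL2)
    (hDel : Delbourgo1998.prop4_rankZero_pow_dvd_constantCoeff)
    (hGZK : rank_eq_analyticRank_of_analyticRank_le_one) (hmod : hasEntireLFunction_rat)
    (hmodD : nonempty_modularParametrizationData)
    (hKatoχ : Wuthrich2014.kato_halfEigenCharIdeal_dvd_cyclotomicPrime_of_surjective)
    (h26 : cremona_abs_maninConstant_eq_one_of_level_le)
    (hCT : exists_casselsTate_pairing (K := ℚ))
    (W : WeierstrassCurve ℚ) [W.IsElliptic] [W.IsGloballyMinimal]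
    {E₀ : WeierstrassCurve ℤ} (hI : integralModelInt W = E₀)
    (hΔ : (3 : ℤ) ∣ E₀.Δ) (hc₄ : (3 : ℤ) ∣ E₀.c₄)
    (htower : ∀ m : ℕ, W.HasSurjectiveModNGaloisRep (3 ^ m : ℕ))
    (ht0 : Nat.card {Q : (W.baseChange ℚ_[3]).toAffine.Point // (3 : ℕ) • Q = 0} = 1)
    (htam : ¬ 3 ∣ W.tamagawaProduct)
    {N : ℕ} [NeZero N] (hN : N ≤ 130000) (D : ModularParametrizationData W N)
    (hopt : ∀ z ∈ D.L.lattice, ∃ w ∈ periodLattice D.f, z = D.c * w)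
    (hPT : poitouTate_selmerStructure_duality ℚ)
    (hEP : ∀ v : HeightOneSpectrum (𝓞 ℚ), localEulerPoincareCharacteristic (v.adicCompletion ℚ))
    (v₃ : HeightOneSpectrum (𝓞 ℚ)) (hv₃ : ((3 : ℕ) : 𝓞 ℚ) ∈ v₃.asIdeal)
    (hPort : KatoKuriharaPortThreeAt W 0 v₃)
    (n : ℕ) [NeZero n] (hn : Kato.IsKolyvaginProduct W 3 1 n)
    (hcyc : ∀ (ℓ : ℕ) [Fact ℓ.Prime], ℓ ∣ n →
      Nat.card {P : ((integralModelInt W).map (Int.castRingHom (ZMod ℓ))).toAffine.Point //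
        3 • P = 0} ≤ 3)
    (ψ : (ℓ : ℕ) → (ZMod ℓ)ˣ →* Multiplicative (ZMod (3 ^ 1)))
    (hψ : ∀ ℓ ∈ n.primeFactors, Function.Surjective (ψ ℓ))
    (hcert : kuriharaNumber D.f (3 ^ 1) n ψ ≠ 0)
    (hzero₁ : kuriharaNumber D.f (3 ^ 1) 1 ψ = 0)
    (ψ₂₇ : (ℓ : ℕ) → (ZMod ℓ)ˣ →* Multiplicative (ZMod (3 ^ 3)))
    (hunit₁ : kuriharaNumber D.f (3 ^ 3) 1 ψ₂₇ ≠ 0) :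
    BSDp W 3 :=
  bsdp_three_of_towerSurj_of_levelOneCertificates_of_facts hKatoS hDel hGZK hmod hmodD hKatoχ h26 hCT W hI
    hΔ hc₄ htower ht0 (analyticRank_eq_zero_of_kuriharaNumber_one_ne_zero hmod D (3 ^ 3) ψ₂₇ hunit₁) htam
    hN D hopt hPT hEP v₃ hv₃ hPort n hn hcyc ψ hψ hcert hzero₁ ψ₂₇ hunit₁

/-- **END-m1 RECORD COROLLARY, NAMED-FACTS form, WITHOUT the analytic-rank binder (potentially MULTIPLICATIVE
rows).**  Exactly n1011-p18's `bsdp_three_potMult_of_levelOneCertificates_of_facts` with `hr` DELETED (`r_an = 0`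
read off `hunit₁`); all other binders unchanged and in the same order.  CLOSES NOTHING; nothing booked.
[cite: Kim2022StructureSelmer, §1.4.3 (PDF p. 7), Thm. 1.9 (6) and Thm. 3.13]
[cite: MazurTateTeitelbaum1986Invent, §I.8 (8.6)] [cite: Rubin2011, Thm. 2.8.4]
[cite: Delbourgo1998, Prop. 4 (p. 144)] [cite: AgasheRibetStein2006, Thm. 2.6 (p. 619)] -/
theorem bsdp_three_potMult_of_levelOneCertificates_of_facts_noRank
    (hKatoS : Kato2004.rankZero_padicValNat_sha_le_sub_localTamagawa_of_additive_potGood_of_imageContainsSL2)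
    (hDel : Delbourgo1998.prop4_rankZero_pow_dvd_constantCoeff)
    (hGZK : rank_eq_analyticRank_of_analyticRank_le_one) (hmod : hasEntireLFunction_rat)
    (hmodD : nonempty_modularParametrizationData)
    (hKatoχ : Wuthrich2014.kato_halfEigenCharIdeal_dvd_cyclotomicPrime_of_surjective)
    (h26 : cremona_abs_maninConstant_eq_one_of_level_le)
    (hCT : exists_casselsTate_pairing (K := ℚ))
    (W : WeierstrassCurve ℚ) [W.IsElliptic] [W.IsGloballyMinimal]
    {E₀ : WeierstrassCurve ℤ} (hI : integralModelInt W = E₀)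
    (hΔ : (3 : ℤ) ∣ E₀.Δ) (hc₄ : (3 : ℤ) ∣ E₀.c₄)
    (hsurj : W.HasSurjectiveModNGaloisRep ((3 : ℕ) : ℤ)) (hjneg : padicValRat 3 W.j < 0)
    (hc3 : ¬ 3 ∣ (W.baseChange ℚ_[3]).localTamagawaNumber ℤ_[3])
    (ht0 : Nat.card {Q : (W.baseChange ℚ_[3]).toAffine.Point // (3 : ℕ) • Q = 0} = 1)
    {N : ℕ} [NeZero N] (hN : N ≤ 130000) (D : ModularParametrizationData W N)
    (hopt : ∀ z ∈ D.L.lattice, ∃ w ∈ periodLattice D.f, z = D.c * w)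
    (hPT : poitouTate_selmerStructure_duality ℚ)
    (hEP : ∀ v : HeightOneSpectrum (𝓞 ℚ), localEulerPoincareCharacteristic (v.adicCompletion ℚ))
    (v₃ : HeightOneSpectrum (𝓞 ℚ)) (hv₃ : ((3 : ℕ) : 𝓞 ℚ) ∈ v₃.asIdeal)
    (hPort : KatoKuriharaPortThreeAt W 0 v₃)
    (n : ℕ) [NeZero n] (hn : Kato.IsKolyvaginProduct W 3 1 n)
    (hcyc : ∀ (ℓ : ℕ) [Fact ℓ.Prime], ℓ ∣ n →
      Nat.card {P : ((integralModelInt W).map (Int.castRingHom (ZMod ℓ))).toAffine.Point //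
        3 • P = 0} ≤ 3)
    (ψ : (ℓ : ℕ) → (ZMod ℓ)ˣ →* Multiplicative (ZMod (3 ^ 1)))
    (hψ : ∀ ℓ ∈ n.primeFactors, Function.Surjective (ψ ℓ))
    (hcert : kuriharaNumber D.f (3 ^ 1) n ψ ≠ 0)
    (hzero₁ : kuriharaNumber D.f (3 ^ 1) 1 ψ = 0)
    (ψ₂₇ : (ℓ : ℕ) → (ZMod ℓ)ˣ →* Multiplicative (ZMod (3 ^ 3)))
    (hunit₁ : kuriharaNumber D.f (3 ^ 3) 1 ψ₂₇ ≠ 0) :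
    BSDp W 3 :=
  bsdp_three_potMult_of_levelOneCertificates_of_facts hKatoS hDel hGZK hmod hmodD hKatoχ h26 hCT W hI hΔ hc₄
    hsurj hjneg hc3 ht0 (analyticRank_eq_zero_of_kuriharaNumber_one_ne_zero hmod D (3 ^ 3) ψ₂₇ hunit₁) hN D
    hopt hPT hEP v₃ hv₃ hPort n hn hcyc ψ hψ hcert hzero₁ ψ₂₇ hunit₁

end Summit.BirchSwinnertonDyer.Rank1Residual.GaloisImage.Assembly

end
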